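import Summits.RiemannHypothesis.RiemannHypothesis.Theorems.Splittings.NbPlateauLock
import Summits.RiemannHypothesis.RiemannHypothesis.Theorems.Splittings.NbCoefficientSignReal
import Mathlib.NumberTheory.Bertrand
import HarnessLib

/-!
# RH-EQUIVALENT·SPLITTING CENSUS (nb, neg) · V37 «PLATEAU / BUDGET-FREE MÖBIUS LOCK» (file 2 of 3: THE LOCK on the `L²(0,∞)` side — `|c_j + μ(j+1)| ≤ 6 σ₁(j+1) · d_N(c)` for EVERY real Báez-Duarte approximant, NO budget, NO zero of ζ, uniform in `N`; the zero-free length law `d_N ≥ 1/(6(2N+1))`; the ζ side for real vectors; symmetrisation); nothing here bears on the truth of RH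

LABEL (line 1): RH-EQUIVALENT·SPLITTING (cell `rh-split`, seat (nb, neg), generation 12, census
candidate V37, file 2 of 3).  Zero definitions; standard axioms; imports file 1
(`Splittings.NbPlateauLock`), the LANDED `Splittings.NbCoefficientSignReal` (reflection identity
`nb_integral_conj`, `nb_lintegral_re_le`) and Mathlib's Bertrand postulate.  Same namespace as file 1.

## Results (`d = √(nbDistSq N c)`, `Φ(n) = Σ_j [j+1 = n] c_j` = the coefficient at Dirichlet index `n`)

* `abs_coeffFn_add_moebius_le` : `|Φ(n) + μ(n)| ≤ 6 σ₁(n) d` for every `n ≥ 1`;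
* `abs_coeff_add_moebius_le` : `|c_j + μ(j+1)| ≤ 6 σ₁(j+1) d` for every `j < N` — THE LOCK
  (effective Báez-Duarte Lemma 4.2: the printed statement is the qualitative `c_j → −μ(j+1)` as
  `d → 0`, in Beurling's class, from pointwise convergence; arXiv:math/0011254 §4);
* `abs_moebius_le_of_length_lt` : `|μ(n)| ≤ 6 σ₁(n) d` for `n > N`, whence the ZERO-FREE LENGTH LAW
  `1 ≤ 6(2N+1) d_N(c)` for EVERY real `c` (`one_le_mul_sqrt_nbDistSq`; a Möbius unit in `(N, 2N]`);
* ζ SIDE for REAL vectors `r` of the route functional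
  `I(N,a) = ∫⁻ ‖1 − ζ(½+it) Σ a_n (n+1)^{−(½+it)}‖²/(¼+t²)` via the landed dictionary
  `I(N, r) = 2π d_N²(−r)`: `I(N,r) ≤ i ⇒ |r_j − μ(j+1)| ≤ 6 σ₁(j+1) √(i/(2π))`
  (`abs_realCoeff_sub_moebius_le_of_lintegral_le`, `abs_moebius_le_of_realCoeffFn_eq_zero`);
* SYMMETRISATION (`nbIntegrand_twist_le`, `nb_integral_twist_le`, `nb_lintegral_twist_le`): for
  `w + w̄ = 1`, `I(N, w a + w̄ ā) ≤ 4‖w‖² I(N, a)` — the bridge to complex vectors used in file 3.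

HONEST LABEL: «SPLITTING SEARCH over kernel-typed RH-EQUIVALENCES; a splitting A ∧ B ⟹ RH is
CONDITIONAL bookkeeping unless A and B are both proved; nothing here bears on the truth of RH.»
-/

set_option linter.dupNamespace false

namespace Summit.RiemannHypothesis.RiemannHypothesis.Theorems.Splittings.NbPlateauLock

open MeasureTheory Set Finset
open scoped ArithmeticFunction.Moebius ArithmeticFunction.zeta ComplexConjugate
open Literature.NumberTheory.LFunctions
open Summit.RiemannHypothesis.RiemannHypothesis.Theorems.NbTheory (nbDistSq)
open Summit.RiemannHypothesis.RiemannHypothesis.Theorems.Splittings.NbLevelCertificate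

/-! ## 4. THE LOCK (L² side) -/

open ArithmeticFunction in
/-- **THE PLATEAU LOCK, all Dirichlet indices.**  For every real `c : Fin N → ℝ` and every `n ≥ 1`:
`|Φ(n) + μ(n)| ≤ 6 σ₁(n) · d_N(c)`, `Φ(n) = Σ_j [j+1 = n] c_j` — no budget, no zero of `ζ`. -/
theorem abs_coeffFn_add_moebius_le (N : ℕ) (c : Fin N → ℝ) {n : ℕ} (hn : n ≠ 0) :
    |(∑ j : Fin N, if (j : ℕ) + 1 = n then c j else 0) + (μ n : ℝ)| ≤
      6 * ((sigma 1 n : ℕ) : ℝ) * Real.sqrt (nbDistSq N c) := by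
  have h := abs_add_moebius_le_of_divisorSums (Real.sqrt_nonneg (nbDistSq N c)) (n := n)
    (Φ := toArithmeticFunction (fun n ↦ ∑ j : Fin N, if (j : ℕ) + 1 = n then c j else 0))
    (fun e he ↦ abs_divisorSum_add_one_le N c (Nat.pos_of_mem_divisors he).ne')
  rwa [show toArithmeticFunction (fun n ↦ ∑ j : Fin N, if (j : ℕ) + 1 = n then c j else 0) n =
    if n = 0 then 0 else ∑ j : Fin N, if (j : ℕ) + 1 = n then c j else 0 from rfl, if_neg hn] at h

open ArithmeticFunction in
/-- **THE PLATEAU LOCK.**  For every real `c : Fin N → ℝ` and every `j < N`: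
`|c_j + μ(j+1)| ≤ 6 σ₁(j+1) · d_N(c)` (`d_N(c) = ‖χ − Σ c_k ρ_{k+1}‖_{L²(0,∞)}`). -/
theorem abs_coeff_add_moebius_le (N : ℕ) (c : Fin N → ℝ) (j : Fin N) :
    |c j + (μ ((j : ℕ) + 1) : ℝ)| ≤
      6 * ((sigma 1 ((j : ℕ) + 1) : ℕ) : ℝ) * Real.sqrt (nbDistSq N c) := by
  have h := abs_coeffFn_add_moebius_le N c (n := (j : ℕ) + 1) (by omega)
  rwa [coeffFn_apply_succ] at h

open ArithmeticFunction in
/-- **Beyond the length**: `|μ(n)| ≤ 6 σ₁(n) · d_N(c)` for every `n > N`. -/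
theorem abs_moebius_le_of_length_lt (N : ℕ) (c : Fin N → ℝ) {n : ℕ} (hn : N < n) :
    |(μ n : ℝ)| ≤ 6 * ((sigma 1 n : ℕ) : ℝ) * Real.sqrt (nbDistSq N c) := by
  have h := abs_coeffFn_add_moebius_le N c (n := n) (by omega)
  rwa [coeffFn_apply_of_length_lt N c hn, zero_add] at h

open ArithmeticFunction in
/-- A Möbius unit just beyond the length (Bertrand): `∃ n > N` with `|μ(n)| = 1` and `σ₁(n) ≤ 2N+1`. -/
theorem exists_moebius_unit_beyond (N : ℕ) :
    ∃ n : ℕ, N < n ∧ |(μ n : ℝ)| = 1 ∧ ((sigma 1 n : ℕ) : ℝ) ≤ 2 * (N : ℝ) + 1 := by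
  rcases Nat.eq_zero_or_pos N with h0 | hpos
  · subst h0
    refine ⟨1, Nat.one_pos, by simp, ?_⟩
    rw [sigma_one_apply, Nat.divisors_one, Finset.sum_singleton]
    norm_num
  · obtain ⟨p, hp, hNp, hp2⟩ := Nat.exists_prime_lt_and_le_two_mul N hpos.ne'
    refine ⟨p, hNp, ?_, ?_⟩
    · rw [moebius_apply_prime hp]
      norm_num
    · rw [sigma_one_apply, hp.divisors, Finset.sum_pair hp.one_lt.ne, Nat.cast_add, Nat.cast_one]
      have : (p : ℝ) ≤ 2 * (N : ℝ) := by exact_mod_cast hp2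
      linarith

/-- **ZERO-FREE LENGTH LAW (L² side).**  For every `N` and every real `c : Fin N → ℝ`:
`1 ≤ 6(2N+1) · d_N(c)`, i.e. `d_N² ≥ 1/(36(2N+1)²)` — from the lock at a prime `N < p ≤ 2N`. -/
theorem one_le_mul_sqrt_nbDistSq (N : ℕ) (c : Fin N → ℝ) :
    1 ≤ 6 * (2 * (N : ℝ) + 1) * Real.sqrt (nbDistSq N c) := by
  obtain ⟨n, hNn, hμ, hσ⟩ := exists_moebius_unit_beyond N
  have h := abs_moebius_le_of_length_lt N c hNn
  rw [hμ] at h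
  have hd0 := Real.sqrt_nonneg (nbDistSq N c)
  nlinarith [mul_le_mul_of_nonneg_right hσ hd0]

/-! ## 5. The ζ side for REAL coefficient vectors (the landed dictionary `I(N, r) = 2π d_N²(−r)`) -/

/-- The dictionary, restated for `a = r` real: `I(N, r) = 2π · d_N²(−r)`. -/
theorem lintegral_real_eq_nbDistSq (N : ℕ) (r : Fin N → ℝ) :
    ∫⁻ t : ℝ, ENNReal.ofReal (‖1 - riemannZeta (1 / 2 + t * Complex.I) *
        ∑ n : Fin N, ((r n : ℝ) : ℂ) * ((n : ℂ) + 1) ^ (-(1 / 2 + t * Complex.I))‖ ^ 2 /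
        (1 / 4 + t ^ 2)) =
      ENNReal.ofReal (2 * Real.pi * nbDistSq N (fun n ↦ -r n)) := by
  have h := lintegral_zetaSide_eq_nbDistSq N (fun n ↦ -r n)
  simp only [Complex.ofReal_neg, neg_neg] at h
  exact h

/-- From an integral bound to a distance bound: `I(N, r) ≤ i` ⇒ `d_N²(−r) ≤ i/(2π)`. -/
theorem nbDistSq_le_of_lintegral_le (N : ℕ) (r : Fin N → ℝ) {i : ℝ} (hi : 0 ≤ i)
    (hI : ∫⁻ t : ℝ, ENNReal.ofReal (‖1 - riemannZeta (1 / 2 + t * Complex.I) *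
        ∑ n : Fin N, ((r n : ℝ) : ℂ) * ((n : ℂ) + 1) ^ (-(1 / 2 + t * Complex.I))‖ ^ 2 /
        (1 / 4 + t ^ 2)) ≤ ENNReal.ofReal i) :
    nbDistSq N (fun n ↦ -r n) ≤ i / (2 * Real.pi) := by
  rw [lintegral_real_eq_nbDistSq] at hI
  have h := (ENNReal.ofReal_le_ofReal_iff hi).mp hI
  rw [le_div_iff₀ (by positivity)]
  linarith

open ArithmeticFunction in
/-- **THE LOCK, ζ side, real coefficients, all indices.**  If `I(N, r) ≤ i` then for every `n ≥ 1`
`|Σ_j [j+1 = n] r_j − μ(n)| ≤ 6 σ₁(n) √(i/(2π))`. -/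
theorem abs_realCoeffFn_sub_moebius_le_of_lintegral_le (N : ℕ) (r : Fin N → ℝ) {i : ℝ}
    (hi : 0 ≤ i)
    (hI : ∫⁻ t : ℝ, ENNReal.ofReal (‖1 - riemannZeta (1 / 2 + t * Complex.I) *
        ∑ n : Fin N, ((r n : ℝ) : ℂ) * ((n : ℂ) + 1) ^ (-(1 / 2 + t * Complex.I))‖ ^ 2 /
        (1 / 4 + t ^ 2)) ≤ ENNReal.ofReal i) {n : ℕ} (hn : n ≠ 0) :
    |(∑ j : Fin N, if (j : ℕ) + 1 = n then r j else 0) - (μ n : ℝ)| ≤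
      6 * ((sigma 1 n : ℕ) : ℝ) * Real.sqrt (i / (2 * Real.pi)) := by
  have hD := nbDistSq_le_of_lintegral_le N r hi hI
  have hlock := abs_coeffFn_add_moebius_le N (fun n ↦ -r n) hn
  have hneg : (∑ j : Fin N, if (j : ℕ) + 1 = n then (fun n ↦ -r n) j else 0) =
      -(∑ j : Fin N, if (j : ℕ) + 1 = n then r j else 0) := by
    rw [← Finset.sum_neg_distrib]
    refine Finset.sum_congr rfl fun j _ ↦ ?_
    split_ifs <;> simp
  rw [hneg, neg_add_eq_sub, abs_sub_comm] at hlock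
  refine hlock.trans ?_
  have hσ : (0 : ℝ) ≤ 6 * ((sigma 1 n : ℕ) : ℝ) := by positivity
  exact mul_le_mul_of_nonneg_left (Real.sqrt_le_sqrt hD) hσ

open ArithmeticFunction in
/-- **THE LOCK, ζ side, real coefficients.**  If `I(N, r) ≤ i` (route functional, real `a = r`) then
`|r_j − μ(j+1)| ≤ 6 σ₁(j+1) √(i/(2π))` for every `j < N` — no budget, no zero of `ζ`, uniform in `N`. -/
theorem abs_realCoeff_sub_moebius_le_of_lintegral_le (N : ℕ) (r : Fin N → ℝ) {i : ℝ} (hi : 0 ≤ i)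
    (hI : ∫⁻ t : ℝ, ENNReal.ofReal (‖1 - riemannZeta (1 / 2 + t * Complex.I) *
        ∑ n : Fin N, ((r n : ℝ) : ℂ) * ((n : ℂ) + 1) ^ (-(1 / 2 + t * Complex.I))‖ ^ 2 /
        (1 / 4 + t ^ 2)) ≤ ENNReal.ofReal i) (j : Fin N) :
    |r j - (μ ((j : ℕ) + 1) : ℝ)| ≤
      6 * ((sigma 1 ((j : ℕ) + 1) : ℕ) : ℝ) * Real.sqrt (i / (2 * Real.pi)) := by
  have h := abs_realCoeffFn_sub_moebius_le_of_lintegral_le N r hi hI (n := (j : ℕ) + 1) (by omega)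
  rwa [coeffFn_apply_succ] at h

open ArithmeticFunction in
/-- **Vanishing coefficients cost**: if `I(N, r) ≤ i` and the coefficient at a Dirichlet index `n ≥ 1`
vanishes (`Σ_j [j+1 = n] r_j = 0`, e.g. `n > N` or `r_{n−1} = 0`) then `|μ(n)| ≤ 6 σ₁(n) √(i/(2π))`. -/
theorem abs_moebius_le_of_realCoeffFn_eq_zero (N : ℕ) (r : Fin N → ℝ) {i : ℝ} (hi : 0 ≤ i)
    (hI : ∫⁻ t : ℝ, ENNReal.ofReal (‖1 - riemannZeta (1 / 2 + t * Complex.I) *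
        ∑ n : Fin N, ((r n : ℝ) : ℂ) * ((n : ℂ) + 1) ^ (-(1 / 2 + t * Complex.I))‖ ^ 2 /
        (1 / 4 + t ^ 2)) ≤ ENNReal.ofReal i) {n : ℕ} (hn : n ≠ 0)
    (h0 : (∑ j : Fin N, if (j : ℕ) + 1 = n then r j else 0) = 0) :
    |(μ n : ℝ)| ≤ 6 * ((sigma 1 n : ℕ) : ℝ) * Real.sqrt (i / (2 * Real.pi)) := by
  have h := abs_realCoeffFn_sub_moebius_le_of_lintegral_le N r hi hI hn
  rwa [h0, zero_sub, abs_neg] at h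


/-! ## 6. Symmetrisation: from REAL to COMPLEX coefficient vectors

For `w + w̄ = 1` and `b_n := w a_n + w̄ ā_n` one has, pointwise on the critical line,
`1 − ζ A_b = w (1 − ζ A_a) + w̄ (1 − ζ A_ā)`, whence `I(N, b) ≤ 4‖w‖² I(N, a)` by the landed
reflection identity `I(N, ā) = I(N, a)` (`NbCoefficientSign.nb_integral_conj`).  With
`w = ½ − iy` the vector `b = Re a + 2y Im a` is REAL, and the real lock applies to it. -/

/-- Pointwise symmetrisation inequality: for `w + conj w = 1` the integrand of the twisted vector
`n ↦ w a_n + w̄ ā_n` is at most `2‖w‖²` times the sum of the integrands of `a` and of `ā`. -/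
theorem nbIntegrand_twist_le {N : ℕ} (a : Fin N → ℂ) (w : ℂ) (hw : w + conj w = 1) (t : ℝ) :
    ‖1 - riemannZeta (1 / 2 + t * Complex.I) *
        ∑ n : Fin N, (w * a n + conj w * conj (a n)) * ((n : ℂ) + 1) ^ (-(1 / 2 + t * Complex.I))‖ ^ 2 /
        (1 / 4 + t ^ 2) ≤
      2 * ‖w‖ ^ 2 * (‖1 - riemannZeta (1 / 2 + t * Complex.I) *
        ∑ n : Fin N, a n * ((n : ℂ) + 1) ^ (-(1 / 2 + t * Complex.I))‖ ^ 2 / (1 / 4 + t ^ 2) +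
      ‖1 - riemannZeta (1 / 2 + t * Complex.I) *
        ∑ n : Fin N, conj (a n) * ((n : ℂ) + 1) ^ (-(1 / 2 + t * Complex.I))‖ ^ 2 /
        (1 / 4 + t ^ 2)) := by
  set s : ℂ := 1 / 2 + t * Complex.I with hs
  have hsum : ∑ n : Fin N, (w * a n + conj w * conj (a n)) * ((n : ℂ) + 1) ^ (-s) =
      w * ∑ n : Fin N, a n * ((n : ℂ) + 1) ^ (-s) +
        conj w * ∑ n : Fin N, conj (a n) * ((n : ℂ) + 1) ^ (-s) := by
    rw [Finset.mul_sum, Finset.mul_sum, ← Finset.sum_add_distrib]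
    exact Finset.sum_congr rfl fun n _ ↦ by ring
  have hmid : 1 - riemannZeta s * ∑ n : Fin N, (w * a n + conj w * conj (a n)) * ((n : ℂ) + 1) ^ (-s) =
      w * (1 - riemannZeta s * ∑ n : Fin N, a n * ((n : ℂ) + 1) ^ (-s)) +
        conj w * (1 - riemannZeta s * ∑ n : Fin N, conj (a n) * ((n : ℂ) + 1) ^ (-s)) := by
    rw [hsum]
    linear_combination -hw
  rw [hmid]
  set p : ℂ := 1 - riemannZeta s * ∑ n : Fin N, a n * ((n : ℂ) + 1) ^ (-s) with hp
  set q : ℂ := 1 - riemannZeta s * ∑ n : Fin N, conj (a n) * ((n : ℂ) + 1) ^ (-s) with hq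
  have hwt : 0 < 1 / 4 + t ^ 2 := by positivity
  have h1 : ‖w * p + conj w * q‖ ≤ ‖w‖ * (‖p‖ + ‖q‖) := by
    calc ‖w * p + conj w * q‖ ≤ ‖w * p‖ + ‖conj w * q‖ := norm_add_le _ _
      _ = ‖w‖ * (‖p‖ + ‖q‖) := by rw [norm_mul, norm_mul, Complex.norm_conj]; ring
  have key : ‖w * p + conj w * q‖ ^ 2 ≤ 2 * ‖w‖ ^ 2 * (‖p‖ ^ 2 + ‖q‖ ^ 2) := by
    calc ‖w * p + conj w * q‖ ^ 2 ≤ (‖w‖ * (‖p‖ + ‖q‖)) ^ 2 :=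
          pow_le_pow_left₀ (norm_nonneg _) h1 2
      _ ≤ 2 * ‖w‖ ^ 2 * (‖p‖ ^ 2 + ‖q‖ ^ 2) := by
          nlinarith [sq_nonneg (‖p‖ - ‖q‖), sq_nonneg ‖w‖]
  calc ‖w * p + conj w * q‖ ^ 2 / (1 / 4 + t ^ 2)
      ≤ 2 * ‖w‖ ^ 2 * (‖p‖ ^ 2 + ‖q‖ ^ 2) / (1 / 4 + t ^ 2) :=
        div_le_div_of_nonneg_right key hwt.le
    _ = 2 * ‖w‖ ^ 2 * (‖p‖ ^ 2 / (1 / 4 + t ^ 2) + ‖q‖ ^ 2 / (1 / 4 + t ^ 2)) := by ring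

/-- Integrated symmetrisation inequality (real Bochner integral of the route integrand):
`∫ (twist) ≤ 4‖w‖² ∫ (a)`, using the landed reflection identity `∫ (ā) = ∫ (a)`. -/
theorem nb_integral_twist_le {N : ℕ} (a : Fin N → ℂ) (w : ℂ) (hw : w + conj w = 1) :
    ∫ t : ℝ, ‖1 - riemannZeta (1 / 2 + t * Complex.I) *
        ∑ n : Fin N, (w * a n + conj w * conj (a n)) * ((n : ℂ) + 1) ^ (-(1 / 2 + t * Complex.I))‖ ^ 2 /
        (1 / 4 + t ^ 2) ≤
      4 * ‖w‖ ^ 2 * ∫ t : ℝ, ‖1 - riemannZeta (1 / 2 + t * Complex.I) *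
        ∑ n : Fin N, a n * ((n : ℂ) + 1) ^ (-(1 / 2 + t * Complex.I))‖ ^ 2 / (1 / 4 + t ^ 2) := by
  have hb := integrable_nbIntegrand (fun n ↦ w * a n + conj w * conj (a n))
  have ha := integrable_nbIntegrand a
  have hca := integrable_nbIntegrand (fun n ↦ conj (a n))
  calc _ ≤ ∫ t : ℝ, 2 * ‖w‖ ^ 2 * (‖1 - riemannZeta (1 / 2 + t * Complex.I) *
          ∑ n : Fin N, a n * ((n : ℂ) + 1) ^ (-(1 / 2 + t * Complex.I))‖ ^ 2 / (1 / 4 + t ^ 2) +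
        ‖1 - riemannZeta (1 / 2 + t * Complex.I) *
          ∑ n : Fin N, conj (a n) * ((n : ℂ) + 1) ^ (-(1 / 2 + t * Complex.I))‖ ^ 2 /
          (1 / 4 + t ^ 2)) :=
        integral_mono hb ((ha.add hca).const_mul _) fun t ↦ nbIntegrand_twist_le a w hw t
    _ = 2 * ‖w‖ ^ 2 * ((∫ t : ℝ, ‖1 - riemannZeta (1 / 2 + t * Complex.I) *
          ∑ n : Fin N, a n * ((n : ℂ) + 1) ^ (-(1 / 2 + t * Complex.I))‖ ^ 2 / (1 / 4 + t ^ 2)) +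
        ∫ t : ℝ, ‖1 - riemannZeta (1 / 2 + t * Complex.I) *
          ∑ n : Fin N, conj (a n) * ((n : ℂ) + 1) ^ (-(1 / 2 + t * Complex.I))‖ ^ 2 /
          (1 / 4 + t ^ 2)) := by
        rw [integral_const_mul, integral_add ha hca]
    _ = _ := by rw [NbCoefficientSign.nb_integral_conj a]; ring

/-- The same for the route functional (`∫⁻ … ENNReal.ofReal …`):
`I(N, w a + w̄ ā) ≤ 4‖w‖² · I(N, a)`. -/
theorem nb_lintegral_twist_le {N : ℕ} (a : Fin N → ℂ) (w : ℂ) (hw : w + conj w = 1) :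
    ∫⁻ t : ℝ, ENNReal.ofReal (‖1 - riemannZeta (1 / 2 + t * Complex.I) *
        ∑ n : Fin N, (w * a n + conj w * conj (a n)) * ((n : ℂ) + 1) ^ (-(1 / 2 + t * Complex.I))‖ ^ 2 /
        (1 / 4 + t ^ 2)) ≤
      ENNReal.ofReal (4 * ‖w‖ ^ 2) * ∫⁻ t : ℝ, ENNReal.ofReal (‖1 - riemannZeta (1 / 2 + t * Complex.I) *
        ∑ n : Fin N, a n * ((n : ℂ) + 1) ^ (-(1 / 2 + t * Complex.I))‖ ^ 2 / (1 / 4 + t ^ 2)) := by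
  rw [nb_lintegral_eq_ofReal_integral (fun n ↦ w * a n + conj w * conj (a n)),
    nb_lintegral_eq_ofReal_integral a, ← ENNReal.ofReal_mul (by positivity)]
  exact ENNReal.ofReal_le_ofReal (nb_integral_twist_le a w hw)

end Summit.RiemannHypothesis.RiemannHypothesis.Theorems.Splittings.NbPlateauLock
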